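import Summits.CriticalPhenomena.PercolationContinuityZ3.Theorems.Transplant.SkelFrm1ReachRowsQD
import Summits.CriticalPhenomena.PercolationContinuityZ3.Theorems.Transplant.SkelPhiReachRadiiQS
import Summits.CriticalPhenomena.PercolationContinuityZ3.Theorems.Transplant.SkelPhiNegReachDeepOS
import Summits.CriticalPhenomena.PercolationContinuityZ3.Theorems.Transplant.SkelFrmBParamsSlotsS
import Summits.CriticalPhenomena.PercolationContinuityZ3.Theorems.Transplant.SkelFrmBChoiceRadii
import Summits.CriticalPhenomena.PercolationContinuityZ3.Theorems.Transplant.SkelFrmBChoiceDefs3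
import Summits.CriticalPhenomena.PercolationContinuityZ3.Theorems.Transplant.SkelFrmBChoiceGeom
import Summits.CriticalPhenomena.PercolationContinuityZ3.Theorems.Transplant.SkelFrmBChoiceLinks
import Summits.CriticalPhenomena.PercolationContinuityZ3.Theorems.Transplant.SkelFrmBChoiceKit
import Summits.CriticalPhenomena.PercolationContinuityZ3.Theorems.Transplant.SkelFrmBChoiceZone
import Summits.CriticalPhenomena.PercolationContinuityZ3.Theorems.Transplant.SkelFrmBChoiceRooms
import Summits.CriticalPhenomena.PercolationContinuityZ3.Theorems.Transplant.SkelFrmBChoiceNums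
import Summits.CriticalPhenomena.PercolationContinuityZ3.Theorems.Transplant.SkelFrmBParamsSchedA
import Summits.CriticalPhenomena.PercolationContinuityZ3.Theorems.Transplant.SkelFrmBParamsCorrKG
import HarnessLib

/-!
# N2 (frames-only node `SamePDropOfSkeletonFrm₁`, OPEN), (C) column: THE CORRIDOR RESIDUE AT ONE PROBE OF A RUN WITH THE RADIUS ROWS AND THE ENTRANCE
# DEPTH DISCHARGED — `PlanarSkeletonFrm.NegB.reachOblAtHNF_frmQ3R_fst/_snd` (fibre block of record `SUS ex mx`; J15's exhibited instance)

Over `reachOblAtHNF_frmQ3D_fst/_snd` (SkelFrm1ReachRowsQD): at a CHOSEN probe of a RUN of the scheme of record the radii are realised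
(`reach_radii_concSG₂NbS`: `rQ α x = rB α v e.2 = E`, `ρ β x du = E − 2`, `rM β (x+du) = F(nQ+1) − Lp`, `nQ α x = nS α v + 1`, `E ≥ E₀ + cOffS·‖x‖₁`,
`E := Erad (gap SUS) 0 (E₀ SUS) (nQ α x)`), the explored neighbours of the fresh world are `E' := E(nS α v)`-deep (`deep_of_run₂bOS`), so with the window
radius `R := E − 3`, the entrance depth `R₀ := E'`, the excess radius `R₁ := Rex E'` (`hR₁_US` at the oriented long map `φL = oriφ Φ.φ (oL …)`, fine
diameter `50·rmax` through `fine_diam_le_mRS`), the world rows of SkelFrmBChoiceRooms (`Rw := E`, `m′ := 25·rmax`, `ctr := cenS x`) and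
`E = E' + gap E'` (`Erad_succ`, `gap' = 0`), every radius/depth/world binder of the D-wrappers is discharged; what remains per probe is the K-G row set +
`N`, THREE FLOORS — (ρ1) `r₀0 RL + 3 ≤ E₀`, (ρ2) `13·(prism box depth) + 4 ≤ E₀`, (ρ3) `∀ k, Rex (E k) + r₀0 RL + 3 ≤ gap (E k)` — the reading/start-box rows
and the budget (stmt-g20's Window/Readings/Len).
builds on p205010 (kernel theorem, internal audit signed; external expert review pending) — nothing in this file uses p205010; nothing here is a claim
about the open node `SamePDropOfSkeletonFrm₁`.
Lane `prim-bschramm`, seat `prim-bschramm-p5` (gen 16; (C) lineage); helper file (`--supports stmt-CriticalPhenomena-4575 --as helper`).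
[cite: KozmaNitzan2024, §4 Lemma 12 (pp. 23–25), pp. 25–27, p. 30 (Step IV)] [cite: MartineauTassion2017, §4.3 Lemma 4.2]
-/

noncomputable section

open MeasureTheory ProbabilityTheory
open scoped ENNReal Classical

namespace Summit.CriticalPhenomena.PercolationContinuityZ3.Theorems.Transplant

namespace PlanarSkeletonFrm

open Literature.Probability.Percolation Literature.Probability.LatticeModels SimpleGraph GadgetSystem ProbeHistory HSiteScheme Contour KNCells
open Literature.Probability.Percolation.KozmaNitzan.Cells (oth sgOf)
open KNCells.KSchA KNLevels ChainPlanar ChainPara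
open Literature.Barriers.CriticalPhenomena (HasExponentialGrowth graphBall graphBall_mono mem_graphBall_self)
open Skel (ReachOblAtHNF excess)
open SkelI (tanOff)
open SkelConc (Consts)
open BoxProdZ2 (ConcRadiiG)
open TwoAxis.Para (modulus)
open Skelφ (oriφ trφ)
open Skelφ.StepI (DataN DataNS OutNS)
open BoxProdZ2 (Erad nQ nS)

namespace NegB

open Neg

section Rad

variable {κ : Consts} {V : Type} [DecidableEq V] [Countable V] {G : SimpleGraph V} [G.LocallyFinite] {Φ : PlanarSkeletonFrm G} {t : V} {p : unitInterval}
  {hC : Φ.CylSubcritical p} {gv fv : Neg.FSlot} {Pv : PSlot} {ex mx : GSlot} {cv : CSlot} {bv : BSlot} {O : OutNS V} {q : unitInterval}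

local notation "g°" => gOf κ Φ t p O gv
local notation "f°" => fOf κ Φ t p O fv
local notation "c°" => cOf κ Φ t p O gv fv cv
local notation "nL°" => nL κ Φ t p O.merged g° f°
local notation "ℓL°" => ℓL κ Φ t p O.merged g° f°
local notation "hL°" => hL κ Φ t p O.merged g° f°
local notation "vL°" => vL κ Φ t p O.merged g° f°
local notation "vβL°" => vβL κ Φ t p O.merged g° f°
local notation "φL°" => φL κ Φ t p O.D O.DT.toDataN O.ori g° f°
local notation "ψ°" => fineOA κ Φ t p O.D O.DT.toDataN O.ori g° f°
local notation "P°" => fcellsS κ Φ t p O.merged g° f° c°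
local notation "Sᵘ" => SUS ex mx κ Φ t p O.merged g° f° q
local notation "Λ°" => schedOfS κ Φ t p O.merged g° f° c° Sᵘ
local notation "b°" => bOf κ Φ t p O gv fv bv
local notation "F°" => prFA κ Φ t p O.merged g° f°
local notation "S°" => (KSchA.mk (ΓQ κ Φ t p O gv fv (SUS ex mx) cv bv q) q κ.δ : KSchA V ℕ)
local notation "FD°" => FDQ κ Φ t p O gv fv (SUS ex mx) cv q
local notation "e₀" => (((0 : Fin 2), true) : MDir)
local notation "e₁" => (((1 : Fin 2), true) : MDir)

set_option maxHeartbeats 800000 in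
/-- **THE (C) RESIDUE OF THE CHOICE FUNCTION OF RECORD AT ONE PROBE OF A RUN, FIRST AXIS, RADII AND DEPTH DISCHARGED** (fibre block `SUS ex mx`):
window radius `R := E(nQ α x) − 3`, entrance depth `R₀ := E(nS α v)` (`deep_of_run₂bOS`), excess radius `R₁ := Rex R₀` (`hR₁_US`), world rows from
SkelFrmBChoiceRooms with `φe :=` the fine map and `m := 50·rmax` (`fine_diam_le_mRS`); left: the K-G row set + `N`, three `E₀`/`gap` floors, the reading
and start-box rows, the budget. [cite: KozmaNitzan2024, §4 Lemma 12 (pp. 23–25), p. 30 (Step IV)] -/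
theorem reachOblAtHNF_frmQ3R_fst (hAt : (choiceAtQ3 κ Φ t p Pv gv fv (SUS ex mx) cv bv hC).AtQNQ O q) (h1 : Φ.types = {t})
    (hp0 : 0 < (p : ℝ)) (hp1 : (p : ℝ) < 1) (mk : ℕ)
    -- the probe, ON A RUN, CHOSEN
    {h : ProbeHistory V} {e : Site 2 × MDir} (hrun : (S°).IsRun₂O G h) (hc : ((S°).astOf₂O G h).st.ochoice KSchA.qNE = some e)
    (hV : (S°).Valid₂O G h e) (hdu : e₀ ∈ (S°).onwardO G h (tgt e)) (hne : e₀ ≠ rev e.2)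
    -- the corridor of record
    {ρ qq W : ℕ} (HK : Skelφ.KGRows nL° ℓL° hL° vL° (KS0.R'0 κ Φ t p O.merged mk) ρ qq W) (N : ℕ)
    -- THE THREE RADIUS FLOORS (ρ1) kit threshold, (ρ2) prism depth, (ρ3) excess inside one gap
    (hρ1 : KS0.r₀0 t O.merged mk (RL κ Φ t p O gv fv) + 3 ≤ Skelφ.Prm.E₀ Sᵘ)
    (hρ2 : (13 : ℤ) * (((N : ℤ) + 1) * nL° + Skelφ.kgZ₀ nL° vL° (KS0.R'0 κ Φ t p O.merged mk) ρ qq N (Skelφ.kgM₁ nL° ℓL° hL° (KS0.R'0 κ Φ t p O.merged mk) ρ W N) (Skelφ.kgM₂ nL° ℓL° hL° vL° (KS0.R'0 κ Φ t p O.merged mk) ρ qq W N) + Skelφ.kgZ₁ nL° ℓL° hL° (KS0.R'0 κ Φ t p O.merged mk) ρ W N (Skelφ.kgM₁ nL° ℓL° hL° (KS0.R'0 κ Φ t p O.merged mk) ρ W N) (Skelφ.kgWm₂ nL° ℓL° hL° (KS0.R'0 κ Φ t p O.merged mk) ρ W N) (Skelφ.kgWp₂ nL° ℓL° hL° (KS0.R'0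 κ Φ t p O.merged mk) ρ W N) (Skelφ.kgM₂ nL° ℓL° hL° vL° (KS0.R'0 κ Φ t p O.merged mk) ρ qq W N)) + 4 ≤ (Skelφ.Prm.E₀ Sᵘ : ℤ))
    (hρ3 : ∀ k : ℕ, Sᵘ.Rex (Erad (Skelφ.Prm.gap Sᵘ) (fun _ => 0) (Skelφ.Prm.E₀ Sᵘ) k) + KS0.r₀0 t O.merged mk (RL κ Φ t p O gv fv) + 3 ≤
      Skelφ.Prm.gap Sᵘ (Erad (Skelφ.Prm.gap Sᵘ) (fun _ => 0) (Skelφ.Prm.E₀ Sᵘ) k))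
    -- READING ROWS of the prism box at the lattice record `prFA`
    (hPl : -(5 * ((P°).r 0 : ℤ)) + 1 ≤ Skelφ.rdLo (F°).A nL° hL° vL° vβL° (F°).c₀ (F°).c₁ (F°).D
        (![-Skelφ.kgZ₀ nL° vL° (KS0.R'0 κ Φ t p O.merged mk) ρ qq N (Skelφ.kgM₁ nL° ℓL° hL° (KS0.R'0 κ Φ t p O.merged mk) ρ W N) (Skelφ.kgM₂ nL° ℓL° hL° vL° (KS0.R'0 κ Φ t p O.merged mk) ρ qq W N), -Skelφ.kgZ₁ nL° ℓL° hL° (KS0.R'0 κ Φ t p O.merged mk) ρ W N (Skelφ.kgM₁ nL° ℓL° hL° (KS0.R'0 κ Φ t p O.merged mk) ρ W N) (Skelφ.kgWm₂ nL° ℓL° hL° (KS0.R'0 κ Φ t p O.merged mk) ρ W N) (Skelφ.kgWp₂ nL° ℓL° hL° (KS0.R'0 κ Φ t p O.merged mk) ρ W N) (Skelφ.kgM₂ nL° ℓL° hL° vL° (KS0.R'0 κ Φ t p O.merged mk) ρ qq W N)])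
        (![((N : ℤ) + 1) * nL° + Skelφ.kgZ₀ nL° vL° (KS0.R'0 κ Φ t p O.merged mk) ρ qq N (Skelφ.kgM₁ nL° ℓL° hL° (KS0.R'0 κ Φ t p O.merged mk) ρ W N) (Skelφ.kgM₂ nL° ℓL° hL° vL° (KS0.R'0 κ Φ t p O.merged mk) ρ qq W N), Skelφ.kgZ₁ nL° ℓL° hL° (KS0.R'0 κ Φ t p O.merged mk) ρ W N (Skelφ.kgM₁ nL° ℓL° hL° (KS0.R'0 κ Φ t p O.merged mk) ρ W N) (Skelφ.kgWm₂ nL° ℓL° hL° (KS0.R'0 κ Φ t p O.merged mk) ρ W N) (Skelφ.kgWp₂ nL° ℓL° hL° (KS0.R'0 κ Φ t p O.merged mk) ρ W N) (Skelφ.kgM₂ nL° ℓL° hL° vL° (KS0.R'0 κ Φ t p O.merged mk) ρ qq W N)]) 0 ∧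
      Skelφ.rdHi (F°).A nL° hL° vL° vβL° (F°).c₀ (F°).c₁ (F°).D
        (![-Skelφ.kgZ₀ nL° vL° (KS0.R'0 κ Φ t p O.merged mk) ρ qq N (Skelφ.kgM₁ nL° ℓL° hL° (KS0.R'0 κ Φ t p O.merged mk) ρ W N) (Skelφ.kgM₂ nL° ℓL° hL° vL° (KS0.R'0 κ Φ t p O.merged mk) ρ qq W N), -Skelφ.kgZ₁ nL° ℓL° hL° (KS0.R'0 κ Φ t p O.merged mk) ρ W N (Skelφ.kgM₁ nL° ℓL° hL° (KS0.R'0 κ Φ t p O.merged mk) ρ W N) (Skelφ.kgWm₂ nL° ℓL° hL° (KS0.R'0 κ Φ t p O.merged mk) ρ W N) (Skelφ.kgWp₂ nL° ℓL° hL° (KS0.R'0 κ Φ t p O.merged mk) ρ W N) (Skelφ.kgM₂ nL° ℓL° hL° vL° (KS0.R'0 κ Φ t p O.merged mk) ρ qq W N)])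
        (![((N : ℤ) + 1) * nL° + Skelφ.kgZ₀ nL° vL° (KS0.R'0 κ Φ t p O.merged mk) ρ qq N (Skelφ.kgM₁ nL° ℓL° hL° (KS0.R'0 κ Φ t p O.merged mk) ρ W N) (Skelφ.kgM₂ nL° ℓL° hL° vL° (KS0.R'0 κ Φ t p O.merged mk) ρ qq W N), Skelφ.kgZ₁ nL° ℓL° hL° (KS0.R'0 κ Φ t p O.merged mk) ρ W N (Skelφ.kgM₁ nL° ℓL° hL° (KS0.R'0 κ Φ t p O.merged mk) ρ W N) (Skelφ.kgWm₂ nL° ℓL° hL° (KS0.R'0 κ Φ t p O.merged mk) ρ W N) (Skelφ.kgWp₂ nL° ℓL° hL° (KS0.R'0 κ Φ t p O.merged mk) ρ W N) (Skelφ.kgM₂ nL° ℓL° hL° vL° (KS0.R'0 κ Φ t p O.merged mk) ρ qq W N)]) 0 ≤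
        22 * ((P°).r 0 : ℤ) - 1)
    (hPt : -(2 * ((P°).r 1 : ℤ)) + 1 ≤ Skelφ.rdLo (F°).A nL° hL° vL° vβL° (F°).c₀ (F°).c₁ (F°).D
        (![-Skelφ.kgZ₀ nL° vL° (KS0.R'0 κ Φ t p O.merged mk) ρ qq N (Skelφ.kgM₁ nL° ℓL° hL° (KS0.R'0 κ Φ t p O.merged mk) ρ W N) (Skelφ.kgM₂ nL° ℓL° hL° vL° (KS0.R'0 κ Φ t p O.merged mk) ρ qq W N), -Skelφ.kgZ₁ nL° ℓL° hL° (KS0.R'0 κ Φ t p O.merged mk) ρ W N (Skelφ.kgM₁ nL° ℓL° hL° (KS0.R'0 κ Φ t p O.merged mk) ρ W N) (Skelφ.kgWm₂ nL° ℓL° hL° (KS0.R'0 κ Φ t p O.merged mk) ρ W N) (Skelφ.kgWp₂ nL° ℓL° hL° (KS0.R'0 κ Φ t p O.merged mk) ρ W N) (Skelφ.kgM₂ nL° ℓL° hL° vL° (KS0.R'0 κ Φ t p O.merged mk) ρ qq W N)])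
        (![((N : ℤ) + 1) * nL° + Skelφ.kgZ₀ nL° vL° (KS0.R'0 κ Φ t p O.merged mk) ρ qq N (Skelφ.kgM₁ nL° ℓL° hL° (KS0.R'0 κ Φ t p O.merged mk) ρ W N) (Skelφ.kgM₂ nL° ℓL° hL° vL° (KS0.R'0 κ Φ t p O.merged mk) ρ qq W N), Skelφ.kgZ₁ nL° ℓL° hL° (KS0.R'0 κ Φ t p O.merged mk) ρ W N (Skelφ.kgM₁ nL° ℓL° hL° (KS0.R'0 κ Φ t p O.merged mk) ρ W N) (Skelφ.kgWm₂ nL° ℓL° hL° (KS0.R'0 κ Φ t p O.merged mk) ρ W N) (Skelφ.kgWp₂ nL° ℓL° hL° (KS0.R'0 κ Φ t p O.merged mk) ρ W N) (Skelφ.kgM₂ nL° ℓL° hL° vL° (KS0.R'0 κ Φ t p O.merged mk) ρ qq W N)]) 1 ∧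
      Skelφ.rdHi (F°).A nL° hL° vL° vβL° (F°).c₀ (F°).c₁ (F°).D
        (![-Skelφ.kgZ₀ nL° vL° (KS0.R'0 κ Φ t p O.merged mk) ρ qq N (Skelφ.kgM₁ nL° ℓL° hL° (KS0.R'0 κ Φ t p O.merged mk) ρ W N) (Skelφ.kgM₂ nL° ℓL° hL° vL° (KS0.R'0 κ Φ t p O.merged mk) ρ qq W N), -Skelφ.kgZ₁ nL° ℓL° hL° (KS0.R'0 κ Φ t p O.merged mk) ρ W N (Skelφ.kgM₁ nL° ℓL° hL° (KS0.R'0 κ Φ t p O.merged mk) ρ W N) (Skelφ.kgWm₂ nL° ℓL° hL° (KS0.R'0 κ Φ t p O.merged mk) ρ W N) (Skelφ.kgWp₂ nL° ℓL° hL° (KS0.R'0 κ Φ t p O.merged mk) ρ W N) (Skelφ.kgM₂ nL° ℓL° hL° vL° (KS0.R'0 κ Φ t p O.merged mk) ρ qq W N)])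
        (![((N : ℤ) + 1) * nL° + Skelφ.kgZ₀ nL° vL° (KS0.R'0 κ Φ t p O.merged mk) ρ qq N (Skelφ.kgM₁ nL° ℓL° hL° (KS0.R'0 κ Φ t p O.merged mk) ρ W N) (Skelφ.kgM₂ nL° ℓL° hL° vL° (KS0.R'0 κ Φ t p O.merged mk) ρ qq W N), Skelφ.kgZ₁ nL° ℓL° hL° (KS0.R'0 κ Φ t p O.merged mk) ρ W N (Skelφ.kgM₁ nL° ℓL° hL° (KS0.R'0 κ Φ t p O.merged mk) ρ W N) (Skelφ.kgWm₂ nL° ℓL° hL° (KS0.R'0 κ Φ t p O.merged mk) ρ W N) (Skelφ.kgWp₂ nL° ℓL° hL° (KS0.R'0 κ Φ t p O.merged mk) ρ W N) (Skelφ.kgM₂ nL° ℓL° hL° vL° (KS0.R'0 κ Φ t p O.merged mk) ρ qq W N)]) 1 ≤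
        2 * ((P°).r 1 : ℤ) - 1)
    -- READING ROWS of the arrival box `[kgLastLo, kgLastHi]` (SkelPhiCorridorKGBoxes)
    (hLl : 20 * ((P°).r 0 : ℤ) - b° 0 + 1 ≤ Skelφ.rdLo (F°).A nL° hL° vL° vβL° (F°).c₀ (F°).c₁ (F°).D (HK.kgLastLo N) (HK.kgLastHi N) 0 ∧
      5 * ((P°).r 0 : ℤ) ≤ Skelφ.rdLo (F°).A nL° hL° vL° vβL° (F°).c₀ (F°).c₁ (F°).D (HK.kgLastLo N) (HK.kgLastHi N) 0 ∧
      Skelφ.rdHi (F°).A nL° hL° vL° vβL° (F°).c₀ (F°).c₁ (F°).D (HK.kgLastLo N) (HK.kgLastHi N) 0 ≤ 20 * ((P°).r 0 : ℤ) + b° 0 - 1 ∧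
      Skelφ.rdHi (F°).A nL° hL° vL° vβL° (F°).c₀ (F°).c₁ (F°).D (HK.kgLastLo N) (HK.kgLastHi N) 0 ≤ 22 * ((P°).r 0 : ℤ))
    (hLt : PCells2S.cenS P° (tgt e + stepVec e₀) 1 - PCells2S.cenS P° (tgt e) 1 - b° 1 + 1 ≤ Skelφ.rdLo (F°).A nL° hL° vL° vβL° (F°).c₀ (F°).c₁ (F°).D (HK.kgLastLo N) (HK.kgLastHi N) 1 ∧
      Skelφ.rdHi (F°).A nL° hL° vL° vβL° (F°).c₀ (F°).c₁ (F°).D (HK.kgLastLo N) (HK.kgLastHi N) 1 ≤ PCells2S.cenS P° (tgt e + stepVec e₀) 1 - PCells2S.cenS P° (tgt e) 1 + b° 1 - 1 ∧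
      -(2 * ((P°).r 1 : ℤ)) ≤ Skelφ.rdLo (F°).A nL° hL° vL° vβL° (F°).c₀ (F°).c₁ (F°).D (HK.kgLastLo N) (HK.kgLastHi N) 1 ∧
      Skelφ.rdHi (F°).A nL° hL° vL° vβL° (F°).c₀ (F°).c₁ (F°).D (HK.kgLastLo N) (HK.kgLastHi N) 1 ≤ 2 * ((P°).r 1 : ℤ))
    -- START-BOX ROWS
    {aW Bx bL : ℤ} (ha : (F°).D * ((F°).c₁ * (nL° : ℤ) * (b° 0 + 1) + (F°).c₀ * |vL°| * (b° 1 + 1)) ≤ (F°).c₀ * (F°).c₁ * (F°).A * modulus nL° hL° vL° vβL° * aW)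
    (hBx : (F°).D * ((b° 1 : ℤ) + 1) ≤ (F°).c₁ * (F°).A * Bx) (hbL : Bx / (Skelφ.shearUnit nL° hL° : ℤ) + 1 ≤ bL)
    (haq : aW ≤ qq) (hbW : bL ≤ ((nL° * ℓL° / Skelφ.shearUnit nL° hL° + 1 + W : ℕ) : ℤ))
    -- the budget
    {nmax : ℕ} (hnmax : (Skelφ.kgCorrSched (HK.kgVals_ok₁ N) (HK.kgVals_ok₂ N) (HK.kgVals_split N)).N ≤ nmax) :
    ReachOblAtHNF G nmax S° FD° Φ.Δ (κ.δr 0) h e ((S°).aOf₂O G h e) e₀ := by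
  obtain ⟨ω, n, rfl⟩ := hrun
  -- the long clause and its numerics
  have hN := eqNumL_of_atQ hAt
  obtain ⟨hn1, hℓ1⟩ := one_le_of_eqNumL κ Φ t p O.merged g° f° hN
  have hκL := (clauseL_of_atQ hAt).2
  obtain ⟨-, -, -, hCq⟩ := factsNS_of_atQ hAt
  have hlipφ := lip_φL κ Φ t p O.D O.DT.toDataN O.ori g° f°
  have hstep := steps_φL κ Φ t p O.D O.DT.toDataN O.ori g° f°
  have hlipψ : Skelφ.Lip G ψ° := lip_fineA_at κ Φ t p O.merged g° f° hlipφ hN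
  have hwsψ : Skelφ.WeakSteps G ψ° := weakSteps_fineA_at κ Φ t p O.merged g° f° hstep hN
  have hψ0 : ψ° t = 0 := fineA_base_at κ Φ t p O.merged g° f° _ hN
  have hΛ : Skelφ.WFS2 (P°).toPCells2 Λ° := schedOfS_WFS2 κ Φ t p O.merged g° f° c° Sᵘ
  have hcolQ : ∀ a x, ∃ y ∈ Skelφ.VWin G ψ° t ((P°).Q x) ((Λ°).rQ a x), ψ° y = (P°).cenS x :=
    hcol_fineA_of_schedS κ Φ t p O.merged g° f° c° hlipφ hstep hN (colQ_schedOfS κ Φ t p O.merged g° f° c° Sᵘ)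
  have hgap := hgap20_US κ Φ t p O.merged g° f° ex mx q
  have hgapc := hgapc_US κ Φ t p O.merged g° f° ex mx q
  have hgapL := hgapL_US κ Φ t p O.merged g° f° ex mx q
  have hoff := offNS_le κ Φ t p O.merged g° f° c° hN hκL
  have hE3 := (three_le_E₀_US κ Φ t p O.merged g° f° ex mx q).1
  have hc' : (((S°).scheme₂O G).ostN KSchA.qNE n ω).ochoice KSchA.qNE = some e := by rw [KSchA.stN_eq₂O]; exact hc
  -- THE RADII AT THE PROBE (realised anchors)
  obtain ⟨hrQ, hrB, hρ, -, hrM, hQS, hxn⟩ := Skelφ.reach_radii_concSG₂NbS (ψ := ψ°) (P := P°) (t := t) (gap := Skelφ.Prm.gap Sᵘ) (gap' := fun _ => 0)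
    (E₀ := Skelφ.Prm.E₀ Sᵘ) (L' := Skelφ.Prm.Lp Sᵘ) (off := offNS κ Φ t p O.merged g° f° c°) (b₀ := b°) (q := q) (δc := κ.δ)
    hgap hgapc hoff (by omega) hψ0 hc hV hdu
  obtain ⟨hDQ, hDρ', hρM, hlin⟩ := Skelφ.reach_radius_rows_concSG₂NbS (ψ := ψ°) (P := P°) (t := t) (gap := Skelφ.Prm.gap Sᵘ)
    (E₀ := Skelφ.Prm.E₀ Sᵘ) (L' := Skelφ.Prm.Lp Sᵘ) (off := offNS κ Φ t p O.merged g° f° c°) (b₀ := b°) (q := q) (δc := κ.δ)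
    hgap hgapc hgapL hoff hE3 hψ0 hc hV hdu
  -- THE ENTRANCE DEPTH ALONG THE RUN
  have hdeep := Skelφ.deep_of_run₂bOS hlipψ hwsψ P° t (Skelφ.Prm.gap Sᵘ) (fun _ => 0) (Skelφ.Prm.E₀ Sᵘ) (Skelφ.Prm.Lp Sᵘ)
    (offNS κ Φ t p O.merged g° f° c°) q κ.δ b° hΛ hψ0 hgap hgapc hoff (by omega) hcolQ ω n hc' hdu ((S°).aOf₂O G ((S°).hst₂O G ω n) e)
  -- the levels, and the radii facts in the scheme-of-record form (definitional unfoldings of `ΓQ`/`schedOfS`/`FDQ`)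
  set E := Erad (Skelφ.Prm.gap Sᵘ) (fun _ => 0) (Skelφ.Prm.E₀ Sᵘ) (nQ ((S°).aOf₁O G ((S°).hst₂O G ω n) e) (tgt e)) with hEdef
  set E' := Erad (Skelφ.Prm.gap Sᵘ) (fun _ => 0) (Skelφ.Prm.E₀ Sᵘ) (nS ((S°).aOf₁O G ((S°).hst₂O G ω n) e) e.1) with hE'def
  have hEE₀ : Skelφ.Prm.E₀ Sᵘ ≤ E := Skel.E₀_le_Erad _ _ _ _
  have hE'E₀ : Skelφ.Prm.E₀ Sᵘ ≤ E' := Skel.E₀_le_Erad _ _ _ _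
  have hrQ' : (Λ°).rQ ((S°).aOf₁O G ((S°).hst₂O G ω n) e) (tgt e) = E := hrQ
  have hrB' : (Λ°).rB ((S°).aOf₁O G ((S°).hst₂O G ω n) e) e.1 e.2 = E := hrB
  have hρ' : ∀ ℓ, (Λ°).ρ ((S°).aOf₂O G ((S°).hst₂O G ω n) e) (tgt e) e₀ ℓ = E - 2 := hρ
  have hQS' : nQ ((S°).aOf₁O G ((S°).hst₂O G ω n) e) (tgt e) = nS ((S°).aOf₁O G ((S°).hst₂O G ω n) e) e.1 + 1 := hQS
  have hlin' : Skelφ.Prm.E₀ Sᵘ + cOffS κ Φ t p O.merged g° f° * (((tgt e) 0).natAbs + ((tgt e) 1).natAbs) ≤ E := hlin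
  have hDQ' : E - 3 + 1 ≤ (Λ°).rQ ((S°).aOf₁O G ((S°).hst₂O G ω n) e) (tgt e) := hDQ
  have hDρ'' : ∀ ℓ, E - 3 + 1 ≤ (Λ°).ρ ((S°).aOf₂O G ((S°).hst₂O G ω n) e) (tgt e) e₀ ℓ := hDρ'
  have hρM' : ∀ ℓ, (Λ°).ρ ((S°).aOf₂O G ((S°).hst₂O G ω n) e) (tgt e) e₀ ℓ + 1 ≤ (Λ°).rM ((S°).aOf₂O G ((S°).hst₂O G ω n) e) (tgt e + stepVec e₀) := hρM
  have hdeep' : ∀ a ∈ (S°).Vx G ((S°).hst₂O G ω n), ∀ b ∈ (S°).Γ.Ewv ((S°).aOf₁O G ((S°).hst₂O G ω n) e) e.1 e.2 ∪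
      (FD°).Hfull ((S°).aOf₂O G ((S°).hst₂O G ω n) e) (tgt e) e₀, b ∉ (S°).Vx G ((S°).hst₂O G ω n) → G.Adj a b → a ∈ graphBall G t E' := hdeep
  have hEsucc : E = E' + Skelφ.Prm.gap Sᵘ E' := by
    rw [hEdef, hQS', BoxProdZ2.Erad_succ, BoxProdZ2.Frad_succ, ← hE'def]; simp
  have hρ3' : Sᵘ.Rex E' + KS0.r₀0 t O.merged mk (RL κ Φ t p O gv fv) + 3 ≤ Skelφ.Prm.gap Sᵘ E' := hρ3 _
  -- the tolerance of the excess device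
  have hη' : Neg.η κ Φ ≤ κ.δr 0 / 2 := by
    have h2 := (Neg.η_pos κ Φ).2.2
    have hk := Neg.δkit_le_δr κ Φ (n := 0) (by norm_num)
    linarith
  refine reachOblAtHNF_frmQ3D_fst hAt h1 hp0 hp1 mk hV hdu hne HK N (R := E - 3) ?_ hDQ' hDρ'' hρM' (R₀ := E') hdeep'
    hPl hPt hLl hLt ha hBx hbL haq hbW ?_
    (φe := ψ°) (Rw := E) (m' := 25 * (P°).rmax) (m := 50 * (fcellsA κ Φ t p O.merged g° f°).rmax) (R₁ := Sᵘ.Rex E')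
    (ctr := PCells2S.cenS P° (tgt e)) ?_ ?_ ?_ ?_ ?_ hnmax
  · -- hr₀R : r₀0 ≤ E − 3
    omega
  · -- hRD : (cOffS‖x‖₁ + 1) + 13·(box) ≤ E − 3
    set Zb : ℤ := (((N : ℤ) + 1) * nL° + Skelφ.kgZ₀ nL° vL° (KS0.R'0 κ Φ t p O.merged mk) ρ qq N (Skelφ.kgM₁ nL° ℓL° hL° (KS0.R'0 κ Φ t p O.merged mk) ρ W N) (Skelφ.kgM₂ nL° ℓL° hL° vL° (KS0.R'0 κ Φ t p O.merged mk) ρ qq W N) + Skelφ.kgZ₁ nL° ℓL° hL° (KS0.R'0 κ Φ t p O.merged mk) ρ W N (Skelφ.kgM₁ nL° ℓL° hL° (KS0.R'0 κ Φ t p O.merged mk) ρ W N) (Skelφ.kgWm₂ nL° ℓL° hL° (KS0.R'0 κ Φ t p O.merged mk) ρ W N) (Skelφ.kgWp₂ nL° ℓL° hL° (KS0.R'0 κ Φ t p O.merged mk) ρ W N) (Skelφ.kgM₂ nL° ℓL° hL° vL° (KS0.R'0 κ Φ t p O.merged mk) ρ qq W N)) with hZb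
    have hcast : (((E - 3 : ℕ)) : ℤ) = (E : ℤ) - 3 := by omega
    rw [hcast]
    have hlinZ : ((Skelφ.Prm.E₀ Sᵘ : ℕ) : ℤ) + ((cOffS κ Φ t p O.merged g° f° * (((tgt e) 0).natAbs + ((tgt e) 1).natAbs) + 1 : ℕ) : ℤ) ≤ (E : ℤ) + 1 := by
      have := hlin'; push_cast at this ⊢; linarith
    linarith [hρ2, hlinZ]
  · -- hWπ : the world lies in `B(t, E)`
    intro b hb
    exact Skelφ.mem_graphBall_of_mem_Ewv_Hfull₂bS (le_of_eq hrB') (le_of_eq hrQ') (fun ℓ => (le_of_eq (hρ' ℓ)).trans (Nat.sub_le _ _)) hb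
  · -- hWpl : planar footprints in `cenS x + Λ_(25·rmax)`
    intro b hb
    exact Skelφ.ψ_mem_box_image_of_mem_Ewv_Hfull₂bS hb
  · -- hm
    show 2 * (25 * (fcellsA κ Φ t p O.merged g° f°).rmax) ≤ 50 * (fcellsA κ Φ t p O.merged g° f°).rmax
    omega
  · -- hR₁ : the excess device at entrance depth `E' + 1`, fine-map diameter `50·rmax`
    intro R'' hR'' Rw' D' A' hD' hdiam hAD hA
    exact hR₁_US κ Φ t p O.merged g° f° ex mx q hCq (oL κ Φ t p O.D O.DT.toDataN O.ori g° f°) hη' t E' R'' hR'' Rw' D' A' hD'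
      (fun d hd d' hd' => fine_diam_le_mRS κ Φ t p O.merged g° f° (mx κ Φ t p O.merged g° f°) hN (hdiam d hd d' hd')) hAD hA
  · -- hR₁R : Rex E' ≤ (E − 3) − r₀0  (one gap absorbs the excess)
    omega

set_option maxHeartbeats 800000 in
/-- **THE (C) RESIDUE OF THE CHOICE FUNCTION OF RECORD AT ONE PROBE OF A RUN, SECOND AXIS, RADII AND DEPTH DISCHARGED** (fibre block `SUS ex mx`):
window radius `R := E(nQ α x) − 3`, entrance depth `R₀ := E(nS α v)` (`deep_of_run₂bOS`), excess radius `R₁ := Rex R₀` (`hR₁_US`), world rows from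
SkelFrmBChoiceRooms with `φe :=` the fine map and `m := 50·rmax` (`fine_diam_le_mRS`); left: the K-G row set + `N`, three `E₀`/`gap` floors, the reading
and start-box rows, the budget. [cite: KozmaNitzan2024, §4 Lemma 12 (pp. 23–25), p. 30 (Step IV)] -/
theorem reachOblAtHNF_frmQ3R_snd (hAt : (choiceAtQ3 κ Φ t p Pv gv fv (SUS ex mx) cv bv hC).AtQNQ O q) (h1 : Φ.types = {t})
    (hp0 : 0 < (p : ℝ)) (hp1 : (p : ℝ) < 1) (mk : ℕ)
    -- the probe, ON A RUN, CHOSEN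
    {h : ProbeHistory V} {e : Site 2 × MDir} (hrun : (S°).IsRun₂O G h) (hc : ((S°).astOf₂O G h).st.ochoice KSchA.qNE = some e)
    (hV : (S°).Valid₂O G h e) (hdu : e₁ ∈ (S°).onwardO G h (tgt e)) (hne : e₁ ≠ rev e.2)
    -- the corridor of record
    {ρ qq W : ℕ} (HK : Skelφ.KGYRows nL° ℓL° hL° vL° (KS0.R'0 κ Φ t p O.merged mk) ρ qq W) (N : ℕ)
    -- THE THREE RADIUS FLOORS (ρ1) kit threshold, (ρ2) prism depth, (ρ3) excess inside one gap
    (hρ1 : KS0.r₀0 t O.merged mk (RL κ Φ t p O gv fv) + 3 ≤ Skelφ.Prm.E₀ Sᵘ)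
    (hρ2 : (13 : ℤ) * (((N : ℤ) + 1) * ((nL° * ℓL° / Skelφ.shearUnit nL° hL° + 1 : ℕ) : ℤ) + Skelφ.kgZY₀ nL° vL° (KS0.R'0 κ Φ t p O.merged mk) ρ W N (Skelφ.kgM₁Y nL° vL° (KS0.R'0 κ Φ t p O.merged mk) ρ W N) (Skelφ.kgWm₂Y nL° vL° (KS0.R'0 κ Φ t p O.merged mk) ρ W N) (Skelφ.kgWp₂Y nL° vL° (KS0.R'0 κ Φ t p O.merged mk) ρ W N) (Skelφ.kgM₂Y nL° ℓL° hL° vL° (KS0.R'0 κ Φ t p O.merged mk) ρ qq W N) + Skelφ.kgZY₁ nL° ℓL° hL° (KS0.R'0 κ Φ t p O.merged mk) ρ qq N (Skelφ.kgM₁Y nL° vL° (KS0.R'0 κ Φ t p O.merged mk) ρ W N) (Skelφ.kgM₂Y nL° ℓL° hL° vL° (KS0.R'0 κ Φ t p O.merged mk) ρ qq W N)) + 4 ≤ (Skelφ.Prm.E₀ Sᵘ : ℤ))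
    (hρ3 : ∀ k : ℕ, Sᵘ.Rex (Erad (Skelφ.Prm.gap Sᵘ) (fun _ => 0) (Skelφ.Prm.E₀ Sᵘ) k) + KS0.r₀0 t O.merged mk (RL κ Φ t p O gv fv) + 3 ≤
      Skelφ.Prm.gap Sᵘ (Erad (Skelφ.Prm.gap Sᵘ) (fun _ => 0) (Skelφ.Prm.E₀ Sᵘ) k))
    -- READING ROWS of the prism box `[(−ZY₀, −ZY₁), (ZY₀, (N+1)·P + ZY₁)]` at the lattice record `prFA`
    (hPl : -(5 * ((P°).r 1 : ℤ)) + 1 ≤ Skelφ.rdLo (F°).A nL° hL° vL° vβL° (F°).c₀ (F°).c₁ (F°).D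
        (![-Skelφ.kgZY₀ nL° vL° (KS0.R'0 κ Φ t p O.merged mk) ρ W N (Skelφ.kgM₁Y nL° vL° (KS0.R'0 κ Φ t p O.merged mk) ρ W N) (Skelφ.kgWm₂Y nL° vL° (KS0.R'0 κ Φ t p O.merged mk) ρ W N) (Skelφ.kgWp₂Y nL° vL° (KS0.R'0 κ Φ t p O.merged mk) ρ W N) (Skelφ.kgM₂Y nL° ℓL° hL° vL° (KS0.R'0 κ Φ t p O.merged mk) ρ qq W N), -Skelφ.kgZY₁ nL° ℓL° hL° (KS0.R'0 κ Φ t p O.merged mk) ρ qq N (Skelφ.kgM₁Y nL° vL° (KS0.R'0 κ Φ t p O.merged mk) ρ W N) (Skelφ.kgM₂Y nL° ℓL° hL° vL° (KS0.R'0 κ Φ t p O.merged mk) ρ qq W N)])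
        (![Skelφ.kgZY₀ nL° vL° (KS0.R'0 κ Φ t p O.merged mk) ρ W N (Skelφ.kgM₁Y nL° vL° (KS0.R'0 κ Φ t p O.merged mk) ρ W N) (Skelφ.kgWm₂Y nL° vL° (KS0.R'0 κ Φ t p O.merged mk) ρ W N) (Skelφ.kgWp₂Y nL° vL° (KS0.R'0 κ Φ t p O.merged mk) ρ W N) (Skelφ.kgM₂Y nL° ℓL° hL° vL° (KS0.R'0 κ Φ t p O.merged mk) ρ qq W N),
          ((N : ℤ) + 1) * ((nL° * ℓL° / Skelφ.shearUnit nL° hL° + 1 : ℕ) : ℤ) + Skelφ.kgZY₁ nL° ℓL° hL° (KS0.R'0 κ Φ t p O.merged mk) ρ qq N (Skelφ.kgM₁Y nL° vL° (KS0.R'0 κ Φ t p O.merged mk) ρ W N) (Skelφ.kgM₂Y nL° ℓL° hL° vL° (KS0.R'0 κ Φ t p O.merged mk) ρ qq W N)]) 1 ∧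
      Skelφ.rdHi (F°).A nL° hL° vL° vβL° (F°).c₀ (F°).c₁ (F°).D
        (![-Skelφ.kgZY₀ nL° vL° (KS0.R'0 κ Φ t p O.merged mk) ρ W N (Skelφ.kgM₁Y nL° vL° (KS0.R'0 κ Φ t p O.merged mk) ρ W N) (Skelφ.kgWm₂Y nL° vL° (KS0.R'0 κ Φ t p O.merged mk) ρ W N) (Skelφ.kgWp₂Y nL° vL° (KS0.R'0 κ Φ t p O.merged mk) ρ W N) (Skelφ.kgM₂Y nL° ℓL° hL° vL° (KS0.R'0 κ Φ t p O.merged mk) ρ qq W N), -Skelφ.kgZY₁ nL° ℓL° hL° (KS0.R'0 κ Φ t p O.merged mk) ρ qq N (Skelφ.kgM₁Y nL° vL° (KS0.R'0 κ Φ t p O.merged mk) ρ W N) (Skelφ.kgM₂Y nL° ℓL° hL° vL° (KS0.R'0 κ Φ t p O.merged mk) ρ qq W N)])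
        (![Skelφ.kgZY₀ nL° vL° (KS0.R'0 κ Φ t p O.merged mk) ρ W N (Skelφ.kgM₁Y nL° vL° (KS0.R'0 κ Φ t p O.merged mk) ρ W N) (Skelφ.kgWm₂Y nL° vL° (KS0.R'0 κ Φ t p O.merged mk) ρ W N) (Skelφ.kgWp₂Y nL° vL° (KS0.R'0 κ Φ t p O.merged mk) ρ W N) (Skelφ.kgM₂Y nL° ℓL° hL° vL° (KS0.R'0 κ Φ t p O.merged mk) ρ qq W N),
          ((N : ℤ) + 1) * ((nL° * ℓL° / Skelφ.shearUnit nL° hL° + 1 : ℕ) : ℤ) + Skelφ.kgZY₁ nL° ℓL° hL° (KS0.R'0 κ Φ t p O.merged mk) ρ qq N (Skelφ.kgM₁Y nL° vL° (KS0.R'0 κ Φ t p O.merged mk) ρ W N) (Skelφ.kgM₂Y nL° ℓL° hL° vL° (KS0.R'0 κ Φ t p O.merged mk) ρ qq W N)]) 1 ≤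
        22 * ((P°).r 1 : ℤ) - 1)
    (hPt : -(2 * ((P°).r 0 : ℤ)) + 1 ≤ Skelφ.rdLo (F°).A nL° hL° vL° vβL° (F°).c₀ (F°).c₁ (F°).D
        (![-Skelφ.kgZY₀ nL° vL° (KS0.R'0 κ Φ t p O.merged mk) ρ W N (Skelφ.kgM₁Y nL° vL° (KS0.R'0 κ Φ t p O.merged mk) ρ W N) (Skelφ.kgWm₂Y nL° vL° (KS0.R'0 κ Φ t p O.merged mk) ρ W N) (Skelφ.kgWp₂Y nL° vL° (KS0.R'0 κ Φ t p O.merged mk) ρ W N) (Skelφ.kgM₂Y nL° ℓL° hL° vL° (KS0.R'0 κ Φ t p O.merged mk) ρ qq W N), -Skelφ.kgZY₁ nL° ℓL° hL° (KS0.R'0 κ Φ t p O.merged mk) ρ qq N (Skelφ.kgM₁Y nL° vL° (KS0.R'0 κ Φ t p O.merged mk) ρ W N) (Skelφ.kgM₂Y nL° ℓL° hL° vL° (KS0.R'0 κ Φ t p O.merged mk) ρ qq W N)])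
        (![Skelφ.kgZY₀ nL° vL° (KS0.R'0 κ Φ t p O.merged mk) ρ W N (Skelφ.kgM₁Y nL° vL° (KS0.R'0 κ Φ t p O.merged mk) ρ W N) (Skelφ.kgWm₂Y nL° vL° (KS0.R'0 κ Φ t p O.merged mk) ρ W N) (Skelφ.kgWp₂Y nL° vL° (KS0.R'0 κ Φ t p O.merged mk) ρ W N) (Skelφ.kgM₂Y nL° ℓL° hL° vL° (KS0.R'0 κ Φ t p O.merged mk) ρ qq W N),
          ((N : ℤ) + 1) * ((nL° * ℓL° / Skelφ.shearUnit nL° hL° + 1 : ℕ) : ℤ) + Skelφ.kgZY₁ nL° ℓL° hL° (KS0.R'0 κ Φ t p O.merged mk) ρ qq N (Skelφ.kgM₁Y nL° vL° (KS0.R'0 κ Φ t p O.merged mk) ρ W N) (Skelφ.kgM₂Y nL° ℓL° hL° vL° (KS0.R'0 κ Φ t p O.merged mk) ρ qq W N)]) 0 ∧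
      Skelφ.rdHi (F°).A nL° hL° vL° vβL° (F°).c₀ (F°).c₁ (F°).D
        (![-Skelφ.kgZY₀ nL° vL° (KS0.R'0 κ Φ t p O.merged mk) ρ W N (Skelφ.kgM₁Y nL° vL° (KS0.R'0 κ Φ t p O.merged mk) ρ W N) (Skelφ.kgWm₂Y nL° vL° (KS0.R'0 κ Φ t p O.merged mk) ρ W N) (Skelφ.kgWp₂Y nL° vL° (KS0.R'0 κ Φ t p O.merged mk) ρ W N) (Skelφ.kgM₂Y nL° ℓL° hL° vL° (KS0.R'0 κ Φ t p O.merged mk) ρ qq W N), -Skelφ.kgZY₁ nL° ℓL° hL° (KS0.R'0 κ Φ t p O.merged mk) ρ qq N (Skelφ.kgM₁Y nL° vL° (KS0.R'0 κ Φ t p O.merged mk) ρ W N) (Skelφ.kgM₂Y nL° ℓL° hL° vL° (KS0.R'0 κ Φ t p O.merged mk) ρ qq W N)])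
        (![Skelφ.kgZY₀ nL° vL° (KS0.R'0 κ Φ t p O.merged mk) ρ W N (Skelφ.kgM₁Y nL° vL° (KS0.R'0 κ Φ t p O.merged mk) ρ W N) (Skelφ.kgWm₂Y nL° vL° (KS0.R'0 κ Φ t p O.merged mk) ρ W N) (Skelφ.kgWp₂Y nL° vL° (KS0.R'0 κ Φ t p O.merged mk) ρ W N) (Skelφ.kgM₂Y nL° ℓL° hL° vL° (KS0.R'0 κ Φ t p O.merged mk) ρ qq W N),
          ((N : ℤ) + 1) * ((nL° * ℓL° / Skelφ.shearUnit nL° hL° + 1 : ℕ) : ℤ) + Skelφ.kgZY₁ nL° ℓL° hL° (KS0.R'0 κ Φ t p O.merged mk) ρ qq N (Skelφ.kgM₁Y nL° vL° (KS0.R'0 κ Φ t p O.merged mk) ρ W N) (Skelφ.kgM₂Y nL° ℓL° hL° vL° (KS0.R'0 κ Φ t p O.merged mk) ρ qq W N)]) 0 ≤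
        2 * ((P°).r 0 : ℤ) - 1)
    -- READING ROWS of the arrival box `[kgLastLoY, kgLastHiY]` (SkelPhiCorridorKGBoxes)
    (hLl : 20 * ((P°).r 1 : ℤ) - b° 1 + 1 ≤ Skelφ.rdLo (F°).A nL° hL° vL° vβL° (F°).c₀ (F°).c₁ (F°).D (HK.kgLastLoY N) (HK.kgLastHiY N) 1 ∧
      5 * ((P°).r 1 : ℤ) ≤ Skelφ.rdLo (F°).A nL° hL° vL° vβL° (F°).c₀ (F°).c₁ (F°).D (HK.kgLastLoY N) (HK.kgLastHiY N) 1 ∧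
      Skelφ.rdHi (F°).A nL° hL° vL° vβL° (F°).c₀ (F°).c₁ (F°).D (HK.kgLastLoY N) (HK.kgLastHiY N) 1 ≤ 20 * ((P°).r 1 : ℤ) + b° 1 - 1 ∧
      Skelφ.rdHi (F°).A nL° hL° vL° vβL° (F°).c₀ (F°).c₁ (F°).D (HK.kgLastLoY N) (HK.kgLastHiY N) 1 ≤ 22 * ((P°).r 1 : ℤ))
    (hLt : PCells2S.cenS P° (tgt e + stepVec e₁) 0 - PCells2S.cenS P° (tgt e) 0 - b° 0 + 1 ≤ Skelφ.rdLo (F°).A nL° hL° vL° vβL° (F°).c₀ (F°).c₁ (F°).D (HK.kgLastLoY N) (HK.kgLastHiY N) 0 ∧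
      Skelφ.rdHi (F°).A nL° hL° vL° vβL° (F°).c₀ (F°).c₁ (F°).D (HK.kgLastLoY N) (HK.kgLastHiY N) 0 ≤ PCells2S.cenS P° (tgt e + stepVec e₁) 0 - PCells2S.cenS P° (tgt e) 0 + b° 0 - 1 ∧
      -(2 * ((P°).r 0 : ℤ)) ≤ Skelφ.rdLo (F°).A nL° hL° vL° vβL° (F°).c₀ (F°).c₁ (F°).D (HK.kgLastLoY N) (HK.kgLastHiY N) 0 ∧
      Skelφ.rdHi (F°).A nL° hL° vL° vβL° (F°).c₀ (F°).c₁ (F°).D (HK.kgLastLoY N) (HK.kgLastHiY N) 0 ≤ 2 * ((P°).r 0 : ℤ))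
    -- START-BOX ROWS (`aW ≤ (n ± v) + W`, `bL ≤ qq`)
    {aW Bx bL : ℤ} (ha : (F°).D * ((F°).c₁ * (nL° : ℤ) * (b° 0 + 1) + (F°).c₀ * |vL°| * (b° 1 + 1)) ≤ (F°).c₀ * (F°).c₁ * (F°).A * modulus nL° hL° vL° vβL° * aW)
    (hBx : (F°).D * ((b° 1 : ℤ) + 1) ≤ (F°).c₁ * (F°).A * Bx) (hbL : Bx / (Skelφ.shearUnit nL° hL° : ℤ) + 1 ≤ bL)
    (haW : aW ≤ ((((nL° : ℤ) + vL°).toNat + W : ℕ) : ℤ)) (haW' : aW ≤ ((((nL° : ℤ) - vL°).toNat + W : ℕ) : ℤ)) (hbq : bL ≤ qq)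
    -- the budget
    {nmax : ℕ} (hnmax : (Skelφ.kgCorrSchedY HK.hn HK.hv HK.hlay (HK.kgYVals_ok₁ N) (HK.kgYVals_ok₂ N) (HK.kgYVals_split N)).N ≤ nmax) :
    ReachOblAtHNF G nmax S° FD° Φ.Δ (κ.δr 0) h e ((S°).aOf₂O G h e) e₁ := by
  obtain ⟨ω, n, rfl⟩ := hrun
  -- the long clause and its numerics
  have hN := eqNumL_of_atQ hAt
  obtain ⟨hn1, hℓ1⟩ := one_le_of_eqNumL κ Φ t p O.merged g° f° hN
  have hκL := (clauseL_of_atQ hAt).2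
  obtain ⟨-, -, -, hCq⟩ := factsNS_of_atQ hAt
  have hlipφ := lip_φL κ Φ t p O.D O.DT.toDataN O.ori g° f°
  have hstep := steps_φL κ Φ t p O.D O.DT.toDataN O.ori g° f°
  have hlipψ : Skelφ.Lip G ψ° := lip_fineA_at κ Φ t p O.merged g° f° hlipφ hN
  have hwsψ : Skelφ.WeakSteps G ψ° := weakSteps_fineA_at κ Φ t p O.merged g° f° hstep hN
  have hψ0 : ψ° t = 0 := fineA_base_at κ Φ t p O.merged g° f° _ hN
  have hΛ : Skelφ.WFS2 (P°).toPCells2 Λ° := schedOfS_WFS2 κ Φ t p O.merged g° f° c° Sᵘ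
  have hcolQ : ∀ a x, ∃ y ∈ Skelφ.VWin G ψ° t ((P°).Q x) ((Λ°).rQ a x), ψ° y = (P°).cenS x :=
    hcol_fineA_of_schedS κ Φ t p O.merged g° f° c° hlipφ hstep hN (colQ_schedOfS κ Φ t p O.merged g° f° c° Sᵘ)
  have hgap := hgap20_US κ Φ t p O.merged g° f° ex mx q
  have hgapc := hgapc_US κ Φ t p O.merged g° f° ex mx q
  have hgapL := hgapL_US κ Φ t p O.merged g° f° ex mx q
  have hoff := offNS_le κ Φ t p O.merged g° f° c° hN hκL
  have hE3 := (three_le_E₀_US κ Φ t p O.merged g° f° ex mx q).1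
  have hc' : (((S°).scheme₂O G).ostN KSchA.qNE n ω).ochoice KSchA.qNE = some e := by rw [KSchA.stN_eq₂O]; exact hc
  -- THE RADII AT THE PROBE (realised anchors)
  obtain ⟨hrQ, hrB, hρ, -, hrM, hQS, hxn⟩ := Skelφ.reach_radii_concSG₂NbS (ψ := ψ°) (P := P°) (t := t) (gap := Skelφ.Prm.gap Sᵘ) (gap' := fun _ => 0)
    (E₀ := Skelφ.Prm.E₀ Sᵘ) (L' := Skelφ.Prm.Lp Sᵘ) (off := offNS κ Φ t p O.merged g° f° c°) (b₀ := b°) (q := q) (δc := κ.δ)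
    hgap hgapc hoff (by omega) hψ0 hc hV hdu
  obtain ⟨hDQ, hDρ', hρM, hlin⟩ := Skelφ.reach_radius_rows_concSG₂NbS (ψ := ψ°) (P := P°) (t := t) (gap := Skelφ.Prm.gap Sᵘ)
    (E₀ := Skelφ.Prm.E₀ Sᵘ) (L' := Skelφ.Prm.Lp Sᵘ) (off := offNS κ Φ t p O.merged g° f° c°) (b₀ := b°) (q := q) (δc := κ.δ)
    hgap hgapc hgapL hoff hE3 hψ0 hc hV hdu
  -- THE ENTRANCE DEPTH ALONG THE RUN
  have hdeep := Skelφ.deep_of_run₂bOS hlipψ hwsψ P° t (Skelφ.Prm.gap Sᵘ) (fun _ => 0) (Skelφ.Prm.E₀ Sᵘ) (Skelφ.Prm.Lp Sᵘ)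
    (offNS κ Φ t p O.merged g° f° c°) q κ.δ b° hΛ hψ0 hgap hgapc hoff (by omega) hcolQ ω n hc' hdu ((S°).aOf₂O G ((S°).hst₂O G ω n) e)
  -- the levels, and the radii facts in the scheme-of-record form (definitional unfoldings of `ΓQ`/`schedOfS`/`FDQ`)
  set E := Erad (Skelφ.Prm.gap Sᵘ) (fun _ => 0) (Skelφ.Prm.E₀ Sᵘ) (nQ ((S°).aOf₁O G ((S°).hst₂O G ω n) e) (tgt e)) with hEdef
  set E' := Erad (Skelφ.Prm.gap Sᵘ) (fun _ => 0) (Skelφ.Prm.E₀ Sᵘ) (nS ((S°).aOf₁O G ((S°).hst₂O G ω n) e) e.1) with hE'def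
  have hEE₀ : Skelφ.Prm.E₀ Sᵘ ≤ E := Skel.E₀_le_Erad _ _ _ _
  have hE'E₀ : Skelφ.Prm.E₀ Sᵘ ≤ E' := Skel.E₀_le_Erad _ _ _ _
  have hrQ' : (Λ°).rQ ((S°).aOf₁O G ((S°).hst₂O G ω n) e) (tgt e) = E := hrQ
  have hrB' : (Λ°).rB ((S°).aOf₁O G ((S°).hst₂O G ω n) e) e.1 e.2 = E := hrB
  have hρ' : ∀ ℓ, (Λ°).ρ ((S°).aOf₂O G ((S°).hst₂O G ω n) e) (tgt e) e₁ ℓ = E - 2 := hρ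
  have hQS' : nQ ((S°).aOf₁O G ((S°).hst₂O G ω n) e) (tgt e) = nS ((S°).aOf₁O G ((S°).hst₂O G ω n) e) e.1 + 1 := hQS
  have hlin' : Skelφ.Prm.E₀ Sᵘ + cOffS κ Φ t p O.merged g° f° * (((tgt e) 0).natAbs + ((tgt e) 1).natAbs) ≤ E := hlin
  have hDQ' : E - 3 + 1 ≤ (Λ°).rQ ((S°).aOf₁O G ((S°).hst₂O G ω n) e) (tgt e) := hDQ
  have hDρ'' : ∀ ℓ, E - 3 + 1 ≤ (Λ°).ρ ((S°).aOf₂O G ((S°).hst₂O G ω n) e) (tgt e) e₁ ℓ := hDρ'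
  have hρM' : ∀ ℓ, (Λ°).ρ ((S°).aOf₂O G ((S°).hst₂O G ω n) e) (tgt e) e₁ ℓ + 1 ≤ (Λ°).rM ((S°).aOf₂O G ((S°).hst₂O G ω n) e) (tgt e + stepVec e₁) := hρM
  have hdeep' : ∀ a ∈ (S°).Vx G ((S°).hst₂O G ω n), ∀ b ∈ (S°).Γ.Ewv ((S°).aOf₁O G ((S°).hst₂O G ω n) e) e.1 e.2 ∪
      (FD°).Hfull ((S°).aOf₂O G ((S°).hst₂O G ω n) e) (tgt e) e₁, b ∉ (S°).Vx G ((S°).hst₂O G ω n) → G.Adj a b → a ∈ graphBall G t E' := hdeep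
  have hEsucc : E = E' + Skelφ.Prm.gap Sᵘ E' := by
    rw [hEdef, hQS', BoxProdZ2.Erad_succ, BoxProdZ2.Frad_succ, ← hE'def]; simp
  have hρ3' : Sᵘ.Rex E' + KS0.r₀0 t O.merged mk (RL κ Φ t p O gv fv) + 3 ≤ Skelφ.Prm.gap Sᵘ E' := hρ3 _
  -- the tolerance of the excess device
  have hη' : Neg.η κ Φ ≤ κ.δr 0 / 2 := by
    have h2 := (Neg.η_pos κ Φ).2.2
    have hk := Neg.δkit_le_δr κ Φ (n := 0) (by norm_num)
    linarith
  refine reachOblAtHNF_frmQ3D_snd hAt h1 hp0 hp1 mk hV hdu hne HK N (R := E - 3) ?_ hDQ' hDρ'' hρM' (R₀ := E') hdeep'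
    hPl hPt hLl hLt ha hBx hbL haW haW' hbq ?_
    (φe := ψ°) (Rw := E) (m' := 25 * (P°).rmax) (m := 50 * (fcellsA κ Φ t p O.merged g° f°).rmax) (R₁ := Sᵘ.Rex E')
    (ctr := PCells2S.cenS P° (tgt e)) ?_ ?_ ?_ ?_ ?_ hnmax
  · -- hr₀R : r₀0 ≤ E − 3
    omega
  · -- hRD : (cOffS‖x‖₁ + 1) + 13·(box) ≤ E − 3
    set Zb : ℤ := (((N : ℤ) + 1) * ((nL° * ℓL° / Skelφ.shearUnit nL° hL° + 1 : ℕ) : ℤ) + Skelφ.kgZY₀ nL° vL° (KS0.R'0 κ Φ t p O.merged mk) ρ W N (Skelφ.kgM₁Y nL° vL° (KS0.R'0 κ Φ t p O.merged mk) ρ W N) (Skelφ.kgWm₂Y nL° vL° (KS0.R'0 κ Φ t p O.merged mk) ρ W N) (Skelφ.kgWp₂Y nL° vL° (KS0.R'0 κ Φ t p O.merged mk) ρ W N) (Skelφ.kgM₂Y nL° ℓL° hL° vL° (KS0.R'0 κ Φ t p O.merged mk) ρ qq W N) + Skelφ.kgZY₁ nL° ℓL° hL° (KS0.R'0 κ Φ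 t p O.merged mk) ρ qq N (Skelφ.kgM₁Y nL° vL° (KS0.R'0 κ Φ t p O.merged mk) ρ W N) (Skelφ.kgM₂Y nL° ℓL° hL° vL° (KS0.R'0 κ Φ t p O.merged mk) ρ qq W N)) with hZb
    have hcast : (((E - 3 : ℕ)) : ℤ) = (E : ℤ) - 3 := by omega
    rw [hcast]
    have hlinZ : ((Skelφ.Prm.E₀ Sᵘ : ℕ) : ℤ) + ((cOffS κ Φ t p O.merged g° f° * (((tgt e) 0).natAbs + ((tgt e) 1).natAbs) + 1 : ℕ) : ℤ) ≤ (E : ℤ) + 1 := by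
      have := hlin'; push_cast at this ⊢; linarith
    linarith [hρ2, hlinZ]
  · -- hWπ : the world lies in `B(t, E)`
    intro b hb
    exact Skelφ.mem_graphBall_of_mem_Ewv_Hfull₂bS (le_of_eq hrB') (le_of_eq hrQ') (fun ℓ => (le_of_eq (hρ' ℓ)).trans (Nat.sub_le _ _)) hb
  · -- hWpl : planar footprints in `cenS x + Λ_(25·rmax)`
    intro b hb
    exact Skelφ.ψ_mem_box_image_of_mem_Ewv_Hfull₂bS hb
  · -- hm
    show 2 * (25 * (fcellsA κ Φ t p O.merged g° f°).rmax) ≤ 50 * (fcellsA κ Φ t p O.merged g° f°).rmax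
    omega
  · -- hR₁ : the excess device at entrance depth `E' + 1`, fine-map diameter `50·rmax`
    intro R'' hR'' Rw' D' A' hD' hdiam hAD hA
    exact hR₁_US κ Φ t p O.merged g° f° ex mx q hCq (oL κ Φ t p O.D O.DT.toDataN O.ori g° f°) hη' t E' R'' hR'' Rw' D' A' hD'
      (fun d hd d' hd' => fine_diam_le_mRS κ Φ t p O.merged g° f° (mx κ Φ t p O.merged g° f°) hN (hdiam d hd d' hd')) hAD hA
  · -- hR₁R : Rex E' ≤ (E − 3) − r₀0  (one gap absorbs the excess)
    omega

end Rad

end NegB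

end PlanarSkeletonFrm

end Summit.CriticalPhenomena.PercolationContinuityZ3.Theorems.Transplant

end
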